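import Mathlib
import HarnessLib
import Literature.Probability.LatticeModels.ProductTorusCharSumYoung
import Summits.HubbardSuperconductivity.HubbardSuperconductivity.Theorems.KLProgrammeH10TwoPointLimitSectorMultiplierFat
import Summits.HubbardSuperconductivity.HubbardSuperconductivity.Theorems.KLProgrammeKLRegimeEngineNormsStepDoor

/-!
# Route `KLProgramme` — engine support, route (L2): the thin × thin character sums at a JUMP of scales `n₂ + 2 ≤ n₁` from the
# NEIGHBOURING-scale bounds (plateau telescope + Young on the space-time torus) — jump-uniform overlap constants

Cell gate-hubbard-kl, seat hubbard-kl-k3c2-p3 (g6; row «sector-counting import for the leg-dress bar»).  The blocked birth-level tower of stub (b)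
(`stub_engine_step_norms`, item stmt-HubbardSuperconductivity-20437; E1-TOWER-BLOCKED v3) re-sectorises an increment born at a block boundary `k`
in the thin family of a LATER boundary `J′`, `J′ − k` up to the block length `d ≈ 10`; the re-sectorisation lemmas
(`…EngineNormsJumpResectorisation(Prescribed)`) consume the row/column and per-pair position sums of the overlap kernel
`E(klAnisoFamily J′)·S(F̃_k)`, which p4's `overlap_rowSum/colSum_klAniso_bgmFat_le` and `overlapKernel_sums_le_of_charSum_le` deliver for ANY
`k + 1 ≤ J′` from ONE input: a bound `T` on the `ℓ¹` norms of the space-time character sums of the thin × thin products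
`klAnisoFamily J′ ω₁ · klAnisoFamily k a`.  That input is in the tree only for NEIGHBOURING scales (`charSum_klAnisoPair_le_uniform`,
`n₁ ≤ n₂ + 1`).  This file supplies it at every jump, with no new symbol estimate:

* `klAnisoFamily_eq_sum_mul_of_succ_le` — PLATEAU TELESCOPE: for `k + 1 ≤ j`, `F_{j,ω′} = Σ_{a ∈ S} F_{j,ω′} · F_{k,a}` pointwise, `S` the set of
  `a` whose FAT multiplier meets the support of `F_{j,ω′}` (`#S ≤ 27`, p4's `card_overlap_klAniso_bgmFat_coarse_le`) — because the thin family of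
  index `k` sums to `1` on the support of every finer thin multiplier (`EngineV8.sum_klAnisoFamily_eq_one_of_klAnisoFamily_ne_zero`);
* **`charSum_klAniso_single_le`** — the SINGLE-multiplier bound: for `n ≥ 1`, `Σ_z ‖Σ_q χ_q(z) F_{n,ω}(k_q)‖ ≤ 27 · T` if every neighbouring pair
  `F_{n,ω} · F_{n−1,a}` has character sum `≤ T`;
* **`charSum_klAnisoPair_le_of_jump`** — for `n₂ + 2 ≤ n₁`: `F_{n₁,ω₁}F_{n₂,a} = Σ_{b ∈ S} F_{n₁,ω₁} · (F_{n₂+1,b} F_{n₂,a})` and Young's inequality on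
  the product torus (`Literature.…ProductTorusCharSumYoung.sum_norm_prodCharSum_mul_le`, `|G| = 2M·L²`) give
  `Σ_z ‖cS(F_{n₁,ω₁}F_{n₂,a})‖ ≤ 27 · (2ML²)⁻¹ · T₁ · T`, `T₁` the single bound of `F_{n₁,ω₁}`, `T` the neighbouring pair bound at `(n₂+1, n₂)`;
* **`charSum_klAnisoPair_le_of_neighbouring`** — from a UNIFORM neighbouring bound `T` on the scales `1 ≤ n ≤ N`: for all `n₂ + 1 ≤ n₁ ≤ N`,
  `Σ_z ‖cS(F_{n₁,ω₁}F_{n₂,a})‖ ≤ T + 729 · (2ML²)⁻¹ · T²` — with `T = C_B·M·L²` this is `(C_B + 729C_B²/2)·M·L²`, the same shape, UNIFORM IN THE JUMP.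

* `overlap_jump_sums_le_of_neighbouring` — the CONSUMABLES at a jump `k + 1 ≤ J′`: `hrow′ ≤ 27·(3T_J/(βL²))`, per-pair `hcol₁, hrow₁ ≤ 3T_J/(βL²)`
  (`T_J := T + 729(2ML²)⁻¹T²`) for the overlap kernel `E(klAnisoFamily J′)·S(F̃_k)` — exactly the `cr`, `c₁`, `c₁r` binders of the
  re-sectorisation lemmas of `…EngineNormsJumpResectorisation(Prescribed)`.

Everything is proved; no definitions; nothing about the model is asserted beyond these implications.
[cite: BenfattoGiulianiMastropietro2006, §2.7 (2.66), (2.71a), §2.8 (2.82)-(2.83)]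
-/

noncomputable section

namespace Summit.HubbardSuperconductivity.HubbardSuperconductivity.Theorems.TorusFourierL2

set_option linter.dupNamespace false -- summit = problem name (single-conjunct summit), D-0017

open Finset Literature.MathematicalPhysics.QuantumLattice Literature.Probability.LatticeModels
open Summit.HubbardSuperconductivity.HubbardSuperconductivity.Theorems.KLProgrammeLegKernels
open Summit.HubbardSuperconductivity.HubbardSuperconductivity.Theorems.KLRegimeSplit
open Summit.HubbardSuperconductivity.HubbardSuperconductivity.Theorems.EngineV8

open Classical

variable {L M : ℕ} [NeZero L]

/-! ### §1 The plateau telescope -/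

/-- **Plateau telescope**: for `k + 1 ≤ j`, every thin multiplier of index `j` is the sum of its products with the thin multipliers of index
`k` whose FAT partner meets its support: `F_{j,ω′}(p) = Σ_{a ∈ S} F_{j,ω′}(p)·F_{k,a}(p)`,
`S = {a : ∃ q, F_{j,ω′}(q) ≠ 0 ∧ F̃_{k,a}(q) ≠ 0}`. -/
theorem klAnisoFamily_eq_sum_mul_of_succ_le (β μ : ℝ) (K : TrigPolyC4v) {k j : ℕ} (hj : k + 1 ≤ j) (ω' : Fin (sectorCount j))
    (p : FreqMomentum L M) :
    klAnisoFamily L M β μ K klE0 j ω' p =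
      ∑ a ∈ (univ : Finset (Fin (sectorCount k))).filter (fun a : Fin (sectorCount k) =>
          ∃ q : FreqMomentum L M, klAnisoFamily L M β μ K klE0 j ω' q ≠ 0 ∧
            bgmFatMultiplier L M klE0 β (nambuXiCT L μ K) k a q ≠ 0),
        klAnisoFamily L M β μ K klE0 j ω' p * klAnisoFamily L M β μ K klE0 k a p := by
  have he : (0 : ℝ) < klE0 := by norm_num [klE0]
  by_cases h0 : klAnisoFamily L M β μ K klE0 j ω' p = 0
  · rw [h0]
    exact (sum_eq_zero fun a _ => by rw [zero_mul]).symm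
  · -- the full sum is `F_{j,ω′}(p) · 1`; the terms off `S` vanish
    have hfull : ∑ a : Fin (sectorCount k), klAnisoFamily L M β μ K klE0 j ω' p * klAnisoFamily L M β μ K klE0 k a p =
        klAnisoFamily L M β μ K klE0 j ω' p := by
      rw [← mul_sum, sum_klAnisoFamily_eq_one_of_klAnisoFamily_ne_zero β μ K hj ω' p h0, mul_one]
    refine hfull.symm.trans ?_
    symm
    refine sum_subset ?_ fun a _ ha => ?_
    · exact filter_subset _ _
    -- `a ∉ S`: the thin multiplier of `a` vanishes at `p` (else its fat partner would be nonzero there)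
    have hFa : klAnisoFamily L M β μ K klE0 k a p = 0 := by
      by_contra hne
      refine ha (mem_filter.2 ⟨mem_univ _, p, h0, fun hfat => hne ?_⟩)
      have h := bgmFatMultiplier_mul_bgmMultiplier (L := L) (M := M) he β (nambuXiCT L μ K) k a p
      rw [hfat, zero_mul] at h
      rw [klAnisoFamily, ← h]
    rw [hFa, mul_zero]

/-! ### §2 The single-multiplier bound from the neighbouring pairs -/

variable [NeZero M]

/-- **The single-multiplier character sum from the neighbouring pairs**: for `n ≥ 1`, if every product `F_{n,ω}·F_{n−1,a}` has space-time
character sum of `ℓ¹` norm `≤ T`, then `Σ_z ‖Σ_q χ_q(z) F_{n,ω}(k_q)‖ ≤ 27·T`. -/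
theorem charSum_klAniso_single_le (β μ : ℝ) (K : TrigPolyC4v) {n : ℕ} (hn : 1 ≤ n) (ω : Fin (sectorCount n)) {T : ℝ} (hT0 : 0 ≤ T)
    (hT : ∀ a : Fin (sectorCount (n - 1)), ∑ z : TorusSite 1 (2 * M) × TorusSite 2 L,
      ‖∑ q : TorusSite 1 (2 * M) × TorusSite 2 L, (torusChar q.1 z.1 * torusChar q.2 z.2) •
        (klAnisoFamily L M β μ K klE0 n ω (⟨(q.1 0).val, ZMod.val_lt (q.1 0)⟩, q.2) *
          klAnisoFamily L M β μ K klE0 (n - 1) a (⟨(q.1 0).val, ZMod.val_lt (q.1 0)⟩, q.2))‖ ≤ T) :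
    ∑ z : TorusSite 1 (2 * M) × TorusSite 2 L,
      ‖∑ q : TorusSite 1 (2 * M) × TorusSite 2 L, (torusChar q.1 z.1 * torusChar q.2 z.2) •
        klAnisoFamily L M β μ K klE0 n ω (⟨(q.1 0).val, ZMod.val_lt (q.1 0)⟩, q.2)‖ ≤ 27 * T := by
  have he : (0 : ℝ) < klE0 := by norm_num [klE0]
  have hj : (n - 1) + 1 ≤ n := by omega
  set S := (univ : Finset (Fin (sectorCount (n - 1)))).filter (fun a : Fin (sectorCount (n - 1)) =>
      ∃ q : FreqMomentum L M, klAnisoFamily L M β μ K klE0 n ω q ≠ 0 ∧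
        bgmFatMultiplier L M klE0 β (nambuXiCT L μ K) (n - 1) a q ≠ 0) with hS
  have hScard : S.card ≤ 27 := card_overlap_klAniso_bgmFat_coarse_le he β μ K (by omega) ω
  have htel : ∀ q : TorusSite 1 (2 * M) × TorusSite 2 L,
      klAnisoFamily L M β μ K klE0 n ω (⟨(q.1 0).val, ZMod.val_lt (q.1 0)⟩, q.2) =
        ∑ a ∈ S, klAnisoFamily L M β μ K klE0 n ω (⟨(q.1 0).val, ZMod.val_lt (q.1 0)⟩, q.2) *
          klAnisoFamily L M β μ K klE0 (n - 1) a (⟨(q.1 0).val, ZMod.val_lt (q.1 0)⟩, q.2) :=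
    fun q => klAnisoFamily_eq_sum_mul_of_succ_le β μ K hj ω _
  rw [show (∑ z : TorusSite 1 (2 * M) × TorusSite 2 L,
      ‖∑ q : TorusSite 1 (2 * M) × TorusSite 2 L, (torusChar q.1 z.1 * torusChar q.2 z.2) •
        klAnisoFamily L M β μ K klE0 n ω (⟨(q.1 0).val, ZMod.val_lt (q.1 0)⟩, q.2)‖) =
      ∑ z : TorusSite 1 (2 * M) × TorusSite 2 L,
        ‖∑ q : TorusSite 1 (2 * M) × TorusSite 2 L, (torusChar q.1 z.1 * torusChar q.2 z.2) •
          ∑ a ∈ S, klAnisoFamily L M β μ K klE0 n ω (⟨(q.1 0).val, ZMod.val_lt (q.1 0)⟩, q.2) *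
            klAnisoFamily L M β μ K klE0 (n - 1) a (⟨(q.1 0).val, ZMod.val_lt (q.1 0)⟩, q.2)‖ from
    sum_congr rfl fun z _ => congrArg _ (sum_congr rfl fun q _ => congrArg _ (htel q))]
  refine (sum_norm_charSum_sum_le S _).trans ?_
  calc _ ≤ ∑ _a ∈ S, T := sum_le_sum fun a _ => hT a
    _ = S.card * T := by rw [sum_const, nsmul_eq_mul]
    _ ≤ 27 * T := mul_le_mul_of_nonneg_right (by exact_mod_cast hScard) hT0

/-! ### §3 The jump -/

/-- **Thin × thin at a jump `n₂ + 2 ≤ n₁`**: with `T₁` bounding the single character sum of `F_{n₁,ω₁}` and `T` the neighbouring pairs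
`F_{n₂+1,b}·F_{n₂,a}` (all `b`), `Σ_z ‖Σ_q χ_q(z) F_{n₁,ω₁}(k_q)F_{n₂,a}(k_q)‖ ≤ 27 · (2M·L²)⁻¹ · (T₁ · T)` — plateau telescope through the family
of index `n₂ + 1` and Young's inequality on `(ℤ/2M) × (ℤ/L)²`. -/
theorem charSum_klAnisoPair_le_of_jump (β μ : ℝ) (K : TrigPolyC4v) {n₁ n₂ : ℕ} (hn : n₂ + 2 ≤ n₁) (ω₁ : Fin (sectorCount n₁))
    (a : Fin (sectorCount n₂)) {T₁ T : ℝ} (hT₁0 : 0 ≤ T₁) (hT0 : 0 ≤ T)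
    (hT₁ : ∑ z : TorusSite 1 (2 * M) × TorusSite 2 L,
      ‖∑ q : TorusSite 1 (2 * M) × TorusSite 2 L, (torusChar q.1 z.1 * torusChar q.2 z.2) •
        klAnisoFamily L M β μ K klE0 n₁ ω₁ (⟨(q.1 0).val, ZMod.val_lt (q.1 0)⟩, q.2)‖ ≤ T₁)
    (hT : ∀ b : Fin (sectorCount (n₂ + 1)), ∑ z : TorusSite 1 (2 * M) × TorusSite 2 L,
      ‖∑ q : TorusSite 1 (2 * M) × TorusSite 2 L, (torusChar q.1 z.1 * torusChar q.2 z.2) •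
        (klAnisoFamily L M β μ K klE0 (n₂ + 1) b (⟨(q.1 0).val, ZMod.val_lt (q.1 0)⟩, q.2) *
          klAnisoFamily L M β μ K klE0 n₂ a (⟨(q.1 0).val, ZMod.val_lt (q.1 0)⟩, q.2))‖ ≤ T) :
    ∑ z : TorusSite 1 (2 * M) × TorusSite 2 L,
      ‖∑ q : TorusSite 1 (2 * M) × TorusSite 2 L, (torusChar q.1 z.1 * torusChar q.2 z.2) •
        (klAnisoFamily L M β μ K klE0 n₁ ω₁ (⟨(q.1 0).val, ZMod.val_lt (q.1 0)⟩, q.2) *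
          klAnisoFamily L M β μ K klE0 n₂ a (⟨(q.1 0).val, ZMod.val_lt (q.1 0)⟩, q.2))‖ ≤
      27 * ((((2 * M : ℕ) : ℝ) ^ 1 * (L : ℝ) ^ 2)⁻¹ * (T₁ * T)) := by
  have he : (0 : ℝ) < klE0 := by norm_num [klE0]
  have hj : (n₂ + 1) + 1 ≤ n₁ := by omega
  set S := (univ : Finset (Fin (sectorCount (n₂ + 1)))).filter (fun b : Fin (sectorCount (n₂ + 1)) =>
      ∃ q : FreqMomentum L M, klAnisoFamily L M β μ K klE0 n₁ ω₁ q ≠ 0 ∧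
        bgmFatMultiplier L M klE0 β (nambuXiCT L μ K) (n₂ + 1) b q ≠ 0) with hS
  have hScard : S.card ≤ 27 := card_overlap_klAniso_bgmFat_coarse_le he β μ K (by omega) ω₁
  -- telescope the fine factor through the family of index `n₂ + 1`
  have htel : ∀ q : TorusSite 1 (2 * M) × TorusSite 2 L,
      klAnisoFamily L M β μ K klE0 n₁ ω₁ (⟨(q.1 0).val, ZMod.val_lt (q.1 0)⟩, q.2) *
          klAnisoFamily L M β μ K klE0 n₂ a (⟨(q.1 0).val, ZMod.val_lt (q.1 0)⟩, q.2) =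
        ∑ b ∈ S, klAnisoFamily L M β μ K klE0 n₁ ω₁ (⟨(q.1 0).val, ZMod.val_lt (q.1 0)⟩, q.2) *
          (klAnisoFamily L M β μ K klE0 (n₂ + 1) b (⟨(q.1 0).val, ZMod.val_lt (q.1 0)⟩, q.2) *
            klAnisoFamily L M β μ K klE0 n₂ a (⟨(q.1 0).val, ZMod.val_lt (q.1 0)⟩, q.2)) := by
    intro q
    rw [sum_congr rfl fun b _ => (mul_assoc _ _ _).symm, ← sum_mul, ← klAnisoFamily_eq_sum_mul_of_succ_le β μ K hj ω₁ _]
  rw [show (∑ z : TorusSite 1 (2 * M) × TorusSite 2 L,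
      ‖∑ q : TorusSite 1 (2 * M) × TorusSite 2 L, (torusChar q.1 z.1 * torusChar q.2 z.2) •
        (klAnisoFamily L M β μ K klE0 n₁ ω₁ (⟨(q.1 0).val, ZMod.val_lt (q.1 0)⟩, q.2) *
          klAnisoFamily L M β μ K klE0 n₂ a (⟨(q.1 0).val, ZMod.val_lt (q.1 0)⟩, q.2))‖) =
      ∑ z : TorusSite 1 (2 * M) × TorusSite 2 L,
        ‖∑ q : TorusSite 1 (2 * M) × TorusSite 2 L, (torusChar q.1 z.1 * torusChar q.2 z.2) •
          ∑ b ∈ S, klAnisoFamily L M β μ K klE0 n₁ ω₁ (⟨(q.1 0).val, ZMod.val_lt (q.1 0)⟩, q.2) *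
            (klAnisoFamily L M β μ K klE0 (n₂ + 1) b (⟨(q.1 0).val, ZMod.val_lt (q.1 0)⟩, q.2) *
              klAnisoFamily L M β μ K klE0 n₂ a (⟨(q.1 0).val, ZMod.val_lt (q.1 0)⟩, q.2))‖ from
    sum_congr rfl fun z _ => congrArg _ (sum_congr rfl fun q _ => congrArg _ (htel q))]
  refine (sum_norm_charSum_sum_le S _).trans ?_
  have hG : (0 : ℝ) < (((2 * M : ℕ) : ℝ) ^ 1 * (L : ℝ) ^ 2) := by
    have h1 : (0 : ℝ) < ((2 * M : ℕ) : ℝ) := Nat.cast_pos.2 (Nat.pos_of_ne_zero (NeZero.ne (2 * M)))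
    have h2 : (0 : ℝ) < L := Nat.cast_pos.2 (Nat.pos_of_ne_zero (NeZero.ne L))
    positivity
  have hterm : ∀ b ∈ S, ∑ z : TorusSite 1 (2 * M) × TorusSite 2 L,
      ‖∑ q : TorusSite 1 (2 * M) × TorusSite 2 L, (torusChar q.1 z.1 * torusChar q.2 z.2) •
        (klAnisoFamily L M β μ K klE0 n₁ ω₁ (⟨(q.1 0).val, ZMod.val_lt (q.1 0)⟩, q.2) *
          (klAnisoFamily L M β μ K klE0 (n₂ + 1) b (⟨(q.1 0).val, ZMod.val_lt (q.1 0)⟩, q.2) *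
            klAnisoFamily L M β μ K klE0 n₂ a (⟨(q.1 0).val, ZMod.val_lt (q.1 0)⟩, q.2)))‖ ≤
      (((2 * M : ℕ) : ℝ) ^ 1 * (L : ℝ) ^ 2)⁻¹ * (T₁ * T) := by
    intro b _
    refine (sum_norm_prodCharSum_mul_le (d₁ := 1) (L₁ := 2 * M) (d₂ := 2) (L₂ := L) _ _).trans ?_
    exact mul_le_mul_of_nonneg_left (mul_le_mul hT₁ (hT b) (sum_nonneg fun z _ => norm_nonneg _) hT₁0) (inv_nonneg.2 hG.le)
  calc _ ≤ ∑ _b ∈ S, (((2 * M : ℕ) : ℝ) ^ 1 * (L : ℝ) ^ 2)⁻¹ * (T₁ * T) := sum_le_sum hterm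
    _ = S.card * ((((2 * M : ℕ) : ℝ) ^ 1 * (L : ℝ) ^ 2)⁻¹ * (T₁ * T)) := by rw [sum_const, nsmul_eq_mul]
    _ ≤ 27 * ((((2 * M : ℕ) : ℝ) ^ 1 * (L : ℝ) ^ 2)⁻¹ * (T₁ * T)) :=
        mul_le_mul_of_nonneg_right (by exact_mod_cast hScard) (by positivity)

/-- **Jump-uniform thin × thin character sums from a uniform neighbouring bound**: if for every scale `1 ≤ n ≤ N` every neighbouring product
`F_{n,ω}·F_{n−1,a}` has space-time character sum of `ℓ¹` norm `≤ T`, then for all `n₂ + 1 ≤ n₁ ≤ N` and all sectors,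
`Σ_z ‖Σ_q χ_q(z) F_{n₁,ω₁}(k_q) F_{n₂,a}(k_q)‖ ≤ T + 729 · (2M·L²)⁻¹ · T²` — uniform in the jump `n₁ − n₂`
(p4's `charSum_klAnisoPair_le_uniform` supplies `T = C_B·M·L²`, whence the bound `(C_B + 729·C_B²/2)·M·L²`). -/
theorem charSum_klAnisoPair_le_of_neighbouring (β μ : ℝ) (K : TrigPolyC4v) {N : ℕ} {T : ℝ} (hT0 : 0 ≤ T)
    (hT : ∀ n : ℕ, 1 ≤ n → n ≤ N → ∀ (ω : Fin (sectorCount n)) (a : Fin (sectorCount (n - 1))),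
      ∑ z : TorusSite 1 (2 * M) × TorusSite 2 L,
        ‖∑ q : TorusSite 1 (2 * M) × TorusSite 2 L, (torusChar q.1 z.1 * torusChar q.2 z.2) •
          (klAnisoFamily L M β μ K klE0 n ω (⟨(q.1 0).val, ZMod.val_lt (q.1 0)⟩, q.2) *
            klAnisoFamily L M β μ K klE0 (n - 1) a (⟨(q.1 0).val, ZMod.val_lt (q.1 0)⟩, q.2))‖ ≤ T)
    {n₁ n₂ : ℕ} (hn : n₂ + 1 ≤ n₁) (hN : n₁ ≤ N) (ω₁ : Fin (sectorCount n₁)) (a : Fin (sectorCount n₂)) :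
    ∑ z : TorusSite 1 (2 * M) × TorusSite 2 L,
      ‖∑ q : TorusSite 1 (2 * M) × TorusSite 2 L, (torusChar q.1 z.1 * torusChar q.2 z.2) •
        (klAnisoFamily L M β μ K klE0 n₁ ω₁ (⟨(q.1 0).val, ZMod.val_lt (q.1 0)⟩, q.2) *
          klAnisoFamily L M β μ K klE0 n₂ a (⟨(q.1 0).val, ZMod.val_lt (q.1 0)⟩, q.2))‖ ≤
      T + 729 * ((((2 * M : ℕ) : ℝ) ^ 1 * (L : ℝ) ^ 2)⁻¹ * T ^ 2) := by
  have hG : (0 : ℝ) < (((2 * M : ℕ) : ℝ) ^ 1 * (L : ℝ) ^ 2) := by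
    have h1 : (0 : ℝ) < ((2 * M : ℕ) : ℝ) := Nat.cast_pos.2 (Nat.pos_of_ne_zero (NeZero.ne (2 * M)))
    have h2 : (0 : ℝ) < L := Nat.cast_pos.2 (Nat.pos_of_ne_zero (NeZero.ne L))
    positivity
  have hextra : 0 ≤ 729 * ((((2 * M : ℕ) : ℝ) ^ 1 * (L : ℝ) ^ 2)⁻¹ * T ^ 2) := by positivity
  rcases Nat.lt_or_ge (n₂ + 1) n₁ with hlt | hge
  · -- a genuine jump `n₂ + 2 ≤ n₁`
    have hn2 : n₂ + 2 ≤ n₁ := hlt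
    have hT₁ := charSum_klAniso_single_le (L := L) (M := M) β μ K (n := n₁) (by omega) ω₁ hT0
      (fun a' => hT n₁ (by omega) hN ω₁ a')
    have hnb : ∀ b : Fin (sectorCount (n₂ + 1)), ∑ z : TorusSite 1 (2 * M) × TorusSite 2 L,
        ‖∑ q : TorusSite 1 (2 * M) × TorusSite 2 L, (torusChar q.1 z.1 * torusChar q.2 z.2) •
          (klAnisoFamily L M β μ K klE0 (n₂ + 1) b (⟨(q.1 0).val, ZMod.val_lt (q.1 0)⟩, q.2) *
            klAnisoFamily L M β μ K klE0 n₂ a (⟨(q.1 0).val, ZMod.val_lt (q.1 0)⟩, q.2))‖ ≤ T := by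
      intro b
      exact hT (n₂ + 1) (by omega) (by omega) b a
    refine (charSum_klAnisoPair_le_of_jump β μ K hn2 ω₁ a (by positivity) hT0 hT₁ hnb).trans ?_
    calc 27 * ((((2 * M : ℕ) : ℝ) ^ 1 * (L : ℝ) ^ 2)⁻¹ * (27 * T * T))
        = 729 * ((((2 * M : ℕ) : ℝ) ^ 1 * (L : ℝ) ^ 2)⁻¹ * T ^ 2) := by ring
      _ ≤ T + 729 * ((((2 * M : ℕ) : ℝ) ^ 1 * (L : ℝ) ^ 2)⁻¹ * T ^ 2) := le_add_of_nonneg_left hT0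
  · -- neighbouring scales `n₁ = n₂ + 1`
    have heq : n₁ = n₂ + 1 := le_antisymm hge hn
    subst heq
    exact (hT (n₂ + 1) (by omega) hN ω₁ a).trans (le_add_of_nonneg_right hextra)

/-! ### §4 The consumables at a jump: `hrow′`, `hcol₁`, `hrow₁` of the re-sectorisation lemmas -/

/-- **The overlap constants of `E(klAnisoFamily J′)·S(F̃_k)` at ANY jump `k + 1 ≤ J′ ≤ N` from a uniform neighbouring bound** `T` (scales
`1 ≤ n ≤ N`): with `T_J := T + 729·(2ML²)⁻¹·T²`, (i) every row sum is `≤ 27·(3T_J/(βL²))` (the `cr` / `hrow′` of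
`EngineV8.hubbardSectorKernelNorm_klAniso_jump_le_of_relCount(_split)`), (ii) every per-pair fine-position sum is `≤ 3T_J/(βL²)` (`c₁` / `hcol₁`),
(iii) every per-pair coarse-position sum is `≤ 3T_J/(βL²)` (`c₁r` / `hrow₁` of `EngineV8.hubbardSectorPinnedSum_klAniso_jump_le` and
`EngineV8.hubbardSectorPrescribedSum_klAniso_jump_le_split`) — p4's `overlap_rowSum_klAniso_bgmFat_le`, `charSum_klAniso_bgmFat_le` and
`overlapKernel_sums_le_of_charSum_le` (all already arbitrary-jump given the thin × thin bound) fed with `charSum_klAnisoPair_le_of_neighbouring`.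
With `ε_x = β/(2M)` and `T = C_B·M·L²`: `ε_x·cr ≤ (81/2)(C_B + 729C_B²/2)`, `ε_x·c₁, ε_x·c₁r ≤ (3/2)(C_B + 729C_B²/2)` — uniform in the jump, the
scales, the sectors, `β`, `L`, `M`. -/
theorem overlap_jump_sums_le_of_neighbouring {β : ℝ} (hβ : 0 < β) (μ : ℝ) (K : TrigPolyC4v) {N : ℕ} {T : ℝ} (hT0 : 0 ≤ T)
    (hT : ∀ n : ℕ, 1 ≤ n → n ≤ N → ∀ (ω : Fin (sectorCount n)) (a : Fin (sectorCount (n - 1))),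
      ∑ z : TorusSite 1 (2 * M) × TorusSite 2 L,
        ‖∑ q : TorusSite 1 (2 * M) × TorusSite 2 L, (torusChar q.1 z.1 * torusChar q.2 z.2) •
          (klAnisoFamily L M β μ K klE0 n ω (⟨(q.1 0).val, ZMod.val_lt (q.1 0)⟩, q.2) *
            klAnisoFamily L M β μ K klE0 (n - 1) a (⟨(q.1 0).val, ZMod.val_lt (q.1 0)⟩, q.2))‖ ≤ T)
    {k J' : ℕ} (hJ : k + 1 ≤ J') (hN : J' ≤ N) :
    (∀ X'' : SpaceTimeIdx L M × SectorLeg (sectorCount J'),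
      ∑ X', ‖(sectorAnalysisMatrix L M β (klAnisoFamily L M β μ K klE0 J') *
        sectorSubMatrix L M β (bgmFatMultiplier L M klE0 β (nambuXiCT L μ K) k)) X'' X'‖ ≤
        (27 : ℕ) * (3 * (T + 729 * ((((2 * M : ℕ) : ℝ) ^ 1 * (L : ℝ) ^ 2)⁻¹ * T ^ 2)) / (β * (L : ℝ) ^ 2))) ∧
    (∀ (ω'' : Fin (sectorCount J')) (ω' : Fin (sectorCount k)) (σ c : Fin 2) (x' : SpaceTimeIdx L M),
      ∑ x'' : SpaceTimeIdx L M, ‖(sectorAnalysisMatrix L M β (klAnisoFamily L M β μ K klE0 J') *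
        sectorSubMatrix L M β (bgmFatMultiplier L M klE0 β (nambuXiCT L μ K) k)) (x'', ((ω'', σ), c)) (x', ((ω', σ), c))‖ ≤
        3 * (T + 729 * ((((2 * M : ℕ) : ℝ) ^ 1 * (L : ℝ) ^ 2)⁻¹ * T ^ 2)) / (β * (L : ℝ) ^ 2)) ∧
    (∀ (ω'' : Fin (sectorCount J')) (ω' : Fin (sectorCount k)) (σ c : Fin 2) (x'' : SpaceTimeIdx L M),
      ∑ x' : SpaceTimeIdx L M, ‖(sectorAnalysisMatrix L M β (klAnisoFamily L M β μ K klE0 J') *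
        sectorSubMatrix L M β (bgmFatMultiplier L M klE0 β (nambuXiCT L μ K) k)) (x'', ((ω'', σ), c)) (x', ((ω', σ), c))‖ ≤
        3 * (T + 729 * ((((2 * M : ℕ) : ℝ) ^ 1 * (L : ℝ) ^ 2)⁻¹ * T ^ 2)) / (β * (L : ℝ) ^ 2)) := by
  have he : (0 : ℝ) < klE0 := by norm_num [klE0]
  set TJ : ℝ := T + 729 * ((((2 * M : ℕ) : ℝ) ^ 1 * (L : ℝ) ^ 2)⁻¹ * T ^ 2) with hTJ
  have hTJ0 : 0 ≤ TJ := by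
    have h1 : (0 : ℝ) ≤ ((2 * M : ℕ) : ℝ) := Nat.cast_nonneg _
    have h2 : (0 : ℝ) ≤ L := Nat.cast_nonneg _
    positivity
  -- thin × thin at the jump
  have hpair : ∀ (ω₁ : Fin (sectorCount J')) (a : Fin (sectorCount k)), ∑ z : TorusSite 1 (2 * M) × TorusSite 2 L,
      ‖∑ q : TorusSite 1 (2 * M) × TorusSite 2 L, (torusChar q.1 z.1 * torusChar q.2 z.2) •
        (klAnisoFamily L M β μ K klE0 J' ω₁ (⟨(q.1 0).val, ZMod.val_lt (q.1 0)⟩, q.2) *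
          klAnisoFamily L M β μ K klE0 k a (⟨(q.1 0).val, ZMod.val_lt (q.1 0)⟩, q.2))‖ ≤ TJ :=
    fun ω₁ a => charSum_klAnisoPair_le_of_neighbouring β μ K hT0 hT hJ hN ω₁ a
  -- thin × fat at the jump
  have hfat := fun (ω₁ : Fin (sectorCount J')) (ω₂ : Fin (sectorCount k)) =>
    charSum_klAniso_bgmFat_le (L := L) (M := M) he β μ K hJ ω₁ ω₂ hTJ0 (hpair ω₁)
  have hsums := overlapKernel_sums_le_of_charSum_le hβ (klAnisoFamily L M β μ K klE0 J')
    (bgmFatMultiplier L M klE0 β (nambuXiCT L μ K) k) hfat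
  refine ⟨fun X'' => overlap_rowSum_klAniso_bgmFat_le he hβ μ K hJ hTJ0 hpair X'', fun ω'' ω' σ c x' => ?_,
    fun ω'' ω' σ c x'' => ?_⟩
  · exact hsums.2 ω'' ω' σ c x'
  · exact hsums.1 ω'' ω' σ c x''

end Summit.HubbardSuperconductivity.HubbardSuperconductivity.Theorems.TorusFourierL2

end
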